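import Summits.HodgeConjecture.HodgeConjecture.Theses.LinearSystemTorelli
import Literature.AlgebraicGeometry.HodgeTheory.ComplexGysinCorrespondence
import Literature.AlgebraicGeometry.HodgeTheory.SupportedHodgeClassDescent
import Literature.AlgebraicTopology.SingularHomology.GysinMapSupportProofs
import Literature.AlgebraicGeometry.HodgeTheory.GysinKernelProofs

/-!
# Crux `TranscendentalOrSupported` (stmt-HodgeConjecture-10853), line `Sketch_chow_shadow` —
# stub `stub_corrTail`: a correspondence dying off `T × X` acts into `N¹`

Helper file for the line skeleton `Sketch_chow_shadow` (cohomological transcendental decomposition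
of the diagonal) of the crux `TranscendentalOrSupported` of route `LinearSystemTorelli`
(GHC(2p, coniveau 1) in Grothendieck's sub-Hodge form), registered stub `stub_corrTail`.

Notation: `W`, `X` smooth projective over `ℂ` of dimensions `m`, `n`; `μ` an orientation family;
`γ ∈ H^{2e}((W ⊗ X)(ℂ); ℂ)`; the tree's REAL correspondence action
`corrAction μ hW hX hab γ c = pr_{W*}(pr_X^* c ∪ γ) : Hᵃ(X(ℂ); ℂ) → Hᵇ(W(ℂ); ℂ)`, `a + 2e = b + 2n`
(the FIRST factor receives; `pr_{W*} = complexGysin μ … (fst W X)`).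

CLAIM (`stub_corrTail`, Voisin II (10.8) in support form). If `γ` restricts to `0` on the complex
points of the complement of `pr_W⁻¹ T`, for a Zariski-closed `T ⊆ W` all of whose points have
codimension `≥ 1`, then `corrAction μ hW hX hab γ c ∈ N¹ Hᵇ(W(ℂ); ℂ) = supportedClasses W b 1` for
every `c ∈ Hᵃ(X(ℂ); ℂ)`.

PROOF. `pr_X^* c ∪ γ` dies where `γ` dies (naturality of the cup product under the restriction to
`((W ⊗ X) ∖ pr_W⁻¹ T)(ℂ)`, `cupProduct_map`); the Gysin morphism `pr_{W*} = complexGysin μ …` of a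
class dying off `pr_W⁻¹ T` dies off `T` (`complexGysin_restrictCompl_eq_zero`, fed the tree's
THEOREMS `gysinMap_restrictCompl_eq_zero_of_field ℂ` — Gysin maps commute with restriction to open
subsets, Fulton, *Young Tableaux*, App. B §B.2 Ex. 5 — and `OrientationFamily.hasPoincareDuality μ`);
a class dying off a closed `T` of codimension `≥ 1` lies in `N¹`
(`mem_supportedClasses_of_restrictCompl_eq_zero`). This is the proof of
`GysinFormalism.restrictCompl_corrAct` with the hypothesis-structure Gysin map replaced by the real
`complexGysin μ` and the cycle class `cl Z` by the class `γ`.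

Pure tree theorems; no named fact is taken as a hypothesis and none is introduced.

References: C. Voisin, *Hodge Theory and Complex Algebraic Geometry II* (CUP 2003), proof of
Thm. 10.17, (10.7)–(10.8); W. Fulton, *Young Tableaux* (CUP 1997), App. B §B.1 (5), §B.2 Ex. 5;
A. Grothendieck, *Hodge's general conjecture is false for trivial reasons*, Topology 8 (1969), §1.
-/

-- `Summit.HodgeConjecture.HodgeConjecture.Theorems` is the mandated namespace (single-conjunct summit:
-- Sub = Summit), which `linter.dupNamespace` flags on every declaration; the lakefile turns the
-- linter off tree-wide (weak option), restated here so stand-alone elaboration is warning-free too.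
set_option linter.dupNamespace false

noncomputable section

namespace Summit.HodgeConjecture.HodgeConjecture.Theorems

open CategoryTheory MonoidalCategory CartesianMonoidalCategory
open Literature.AlgebraicGeometry.Motives Literature.AlgebraicGeometry.HodgeTheory
open Literature.AlgebraicTopology.SingularHomology

/-- **A class on `W ⊗ X` dying on `(W ∖ pr_W⁻¹ T ... )(ℂ)` has Gysin push-forward of its cup products
dying off `T`**: for `γ ∈ H^{2e}((W ⊗ X)(ℂ); ℂ)` restricting to `0` on the complex points of the
complement of `pr_W⁻¹ T` (`T ⊆ W` Zariski-closed) and every `c ∈ Hᵃ(X(ℂ); ℂ)`,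
`γ^*(c) = pr_{W*}(pr_X^* c ∪ γ)` restricts to `0` on `(W ∖ T)(ℂ)`: `pr_X^* c ∪ γ` dies where `γ`
dies (`cupProduct_map`), and `pr_{W*}` of a class dying off `pr_W⁻¹ T` dies off `T`
(`complexGysin_restrictCompl_eq_zero` with the theorems `gysinMap_restrictCompl_eq_zero_of_field ℂ`
and `OrientationFamily.hasPoincareDuality μ`).
[cite: VoisinHodgeII2003, proof of Thm. 10.17 (10.8)]
[cite: FultonYoungTableaux1997, Appendix B §B.2 Exercise 5] -/
theorem stub_corrTail_restrictCompl_corrAction (μ : OrientationFamily) {m n : ℕ} {W X : SchemeOver ℂ}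
    (hW : IsSmoothProjective m W) (hX : IsSmoothProjective n X) {e a b : ℕ}
    (hab : a + 2 * e = b + 2 * n) {T : Set W.left} (hT : IsClosed T)
    {γ : complexBetti (W ⊗ X) (2 * e)}
    (hγ : complexBetti.restrictCompl (W ⊗ X) ((fst W X).left.base ⁻¹' T) (2 * e) γ = 0)
    (c : complexBetti X a) :
    complexBetti.restrictCompl W T b (corrAction μ hW hX hab γ c) = 0 := by
  rw [corrAction_apply]
  refine complexGysin_restrictCompl_eq_zero (gysinMap_restrictCompl_eq_zero_of_field ℂ) μ
    (OrientationFamily.hasPoincareDuality μ) (IsSmoothProjective.tensor_holds hW hX) hW (fst W X)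
    (corrAction_degree m hab) hT _ ?_
  rw [complexBetti.restrictCompl, cupProduct_map]
  rw [complexBetti.restrictCompl] at hγ
  rw [hγ, map_zero]

/-- **STUB `stub_corrTail` (Voisin II (10.8) in support form, for the tree's REAL correspondence
action `corrAction μ`, first factor receives)**: if `γ ∈ H^{2e}((W ⊗ X)(ℂ); ℂ)` restricts to `0` on
the complex points of the complement of `pr_W⁻¹ T`, `T ⊆ W` Zariski-closed all of whose points have
codimension `≥ 1`, then `γ^*(c) = pr_{W*}(pr_X^* c ∪ γ)` lies in `N¹ Hᵇ(W(ℂ); ℂ)` for every `c`: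
`γ^*(c)` dies off `T` (`stub_corrTail_restrictCompl_corrAction`), hence
`mem_supportedClasses_of_restrictCompl_eq_zero`.
[cite: VoisinHodgeII2003, proof of Thm. 10.17 (10.8)] [cite: GrothendieckTopology1969, §1] -/
theorem stub_corrTail :
    ∀ (μ : OrientationFamily) ⦃m n : ℕ⦄ ⦃W X : SchemeOver ℂ⦄ (hW : IsSmoothProjective m W)
    (hX : IsSmoothProjective n X) ⦃e a b : ℕ⦄ (hab : a + 2 * e = b + 2 * n) ⦃T : Set W.left⦄,
    IsClosed T → (∀ z ∈ T, (1 : ℕ∞) ≤ Order.coheight z) →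
    ∀ ⦃γ : complexBetti (W ⊗ X) (2 * e)⦄,
    complexBetti.restrictCompl (W ⊗ X) ((fst W X).left.base ⁻¹' T) (2 * e) γ = 0 →
    ∀ c : complexBetti X a, corrAction μ hW hX hab γ c ∈ supportedClasses W b 1 := by
  intro μ m n W X hW hX e a b hab T hT hT1 γ hγ c
  exact mem_supportedClasses_of_restrictCompl_eq_zero hT hT1
    (stub_corrTail_restrictCompl_corrAction μ hW hX hab hT hγ c)

end Summit.HodgeConjecture.HodgeConjecture.Theorems

end
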